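import Literature.InformationTheory.QuantumCodes.RotatedSurfaceCodeSpaceTimeInhomogeneous
import Literature.InformationTheory.QuantumCodes.PlanarCodeCrossingPaths
import HarnessLib

/-!
# The planar surface code as a check matrix drawn on `ℤ²` (`H_X` sector), and its space-time counting bound under
# INHOMOGENEOUS noisy measurement: `Prob[odd bottom-crossing projected residual] ≤ (k+2)·T·C·r^{k+2}/(1-r)`, `r = 2ν√(ρ(1-ρ))`

Topic `Literature/InformationTheory/QuantumCodes` (venture QEC, LADDER-QEC rung Q5, PARTITION row 09 "phenomenological";
qec-type-09 gen 7, line D50.L6 «L-PHENOM», third instance of the generic machinery). All PROVED, kernel axioms, no named fact.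
Gen 6 proved the planar space-time bound for TWO rates `(p, q)` by hand (`PlanarCodeSpaceTime{Lift,Paths,PathsBound,PathsTwoRate}`).
This file re-draws the `H_X` sector of the `k`-th planar code (type-03's lift `PlanarCode.qubitEdge 0`, `PlanarCode.pv 0`:
check `(a, b)` at `(a, b)`, left qubit `(α, b)` = vertical bond `{(α-1, b), (α, b)}`, right qubit `(a, β)` = horizontal bond
`{(a, β), (a, β+1)}`, rough edges `a = -1` / `a = k+1`) as a `CheckDrawing` (`DrawnCheckMatrixCrossingPaths.lean`) and obtains,
through the generic space-time lift and the INHOMOGENEOUS counting bound, the planar space-time bound for an arbitrary field of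
fault rates `≤ ρ` (qubit AND measurement faults, varying with the location and the round):

* `planarDrawing k : CheckDrawing (planarHX k) 2 (Fin (k+2)) (Fin (k+2))` (`bot (α, b)_L = [α = 0]`, `bot (a, β)_R = 0`),
  `planarDrawing_heightGap : HeightGap (k+2)` (height = the row coordinate `a`), `sum_mul_planarDrawing_bot`
  (`Σ_q c(q)·bot(q) = Σ_b c(0, b)_L`, the bottom crossing number of gen 6's files);
* ★ `planar_st_sum_indepWeight_oddResidual_le` — `T` rounds, rates `0 ≤ r_ℓ ≤ ρ ≤ 1/2`, minimum-weight space-time decoder,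
  `cₙ(ℤ³) ≤ C νⁿ`, `r = 2ν√(ρ(1-ρ)) < 1`: `Σ_{E : odd bottom-crossing projected residual} w_r(E) ≤ (k+2)·T·C·r^{k+2}/(1-r)`
  (gen 6's `st_sum_oddResidual_le_twoRate` is the case `r = phenomRate p q`);
* `planar_st_tendsto_sum_indepWeight_oddResidual` — `→ 0` as `k → ∞` for polynomially many rounds when `4ν² ρ(1-ρ) < 1`.

## References

* [DennisEtAl2002] E. Dennis, A. Kitaev, A. Landahl, J. Preskill, *Topological quantum memory*, J. Math. Phys. 43 (2002)
  4452–4505, arXiv:quant-ph/0110143, §3.2 (planar codes, rough edges), §4.2 (independent faults on the links of the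
  space-time lattice), §5.2 eq. (28), §5.3 eqs. (saw_3), (threshold_iso), (fail_iso).
* [TillichZemor2014] J.-P. Tillich, G. Zémor, IEEE Trans. IT 60 (2014) 1193, §3 (the planar code as HGP(H, Hᵀ)).
-/

namespace Literature.InformationTheory.QuantumCodes

namespace PlanarCode

open Finset Matrix Filter Topology CSSPhenom
open Literature.Probability.LatticeModels (Site zdGraph)
open Literature.Probability.RandomPlanarGeometry

variable {k : ℕ}

/-- Sites of the lift are determined by their coordinates. [folklore] -/
private theorem pv_zero_inj {a b a' b' : ℤ} : pv 0 a b = pv 0 a' b' ↔ a = a' ∧ b = b' := by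
  refine ⟨fun h => ?_, by rintro ⟨rfl, rfl⟩; rfl⟩
  have h' : (![a, b] : Site 2) = ![a', b'] := add_right_cancel h
  exact ⟨by simpa using congrFun h' 0, by simpa using congrFun h' 1⟩

/-- The row coordinate of a site of the lift. [folklore] -/
private theorem pv_zero_apply_zero (a b : ℤ) : pv 0 a b 0 = a := by simp [pv]

/-! ### The drawing -/

open Classical in
/-- ★ **The `H_X` sector of the `k`-th planar surface code as a check matrix drawn on `ℤ²`**: the check `(a, b)` at `(a, b)`,
qubits as type-03's bonds `qubitEdge 0`, bottom / top virtual sites `(-1, b)` / `(k+1, b)` (the two rough edges), and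
`bot (α, b)_L = [α = 0]`, `bot (a, β)_R = 0`. [cite: DennisEtAl2002, §3.2 (planar codes: rough edges)] [cite: TillichZemor2014, §3 (HGP(H, Hᵀ))] -/
def planarDrawing (k : ℕ) : CheckDrawing (planarHX k) 2 (Fin (k + 2)) (Fin (k + 2)) where
  site x := pv 0 x.1 x.2
  bond := qubitEdge 0
  vb b := pv 0 (-1) b
  vt b := pv 0 ((k : ℤ) + 1) b
  bot := Sum.elim (fun αb : Fin (k + 2) × Fin (k + 2) => if αb.1.val = 0 then 1 else 0) (fun _ => 0)
  site_injective := by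
    rintro ⟨a, b⟩ ⟨a', b'⟩ h
    have h' := pv_zero_inj.1 h
    simp only at h'
    simp only [Prod.mk.injEq, Fin.ext_iff]
    omega
  bond_injective := qubitEdge_injective 0
  adj_of_bond_eq q P P' h := zdGraph_adj_of_mem_qubitEdge 0 q h
  apply_eq_ite x q := planarHX_apply_eq_ite 0 x.1 x.2 q
  site_ne_vb x b h := by
    have h' := (pv_zero_inj.1 h).1
    omega
  site_ne_vt x b h := by
    have h' := (pv_zero_inj.1 h).1
    have := x.1.2
    omega
  vb_ne_vt b b' h := by
    have h' := (pv_zero_inj.1 h).1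
    omega
  ends_cases := by
    rintro (⟨α, b⟩ | ⟨a, β⟩) P hP
    · simp only [qubitEdge, Sum.elim_inl, Sym2.mem_iff] at hP
      rcases hP with rfl | rfl
      · by_cases hα : α.val = 0
        · exact Or.inr (Or.inl ⟨b, by rw [hα]; norm_num⟩)
        · refine Or.inl ⟨(⟨α.val - 1, by omega⟩, b), ?_⟩
          show pv 0 _ _ = pv 0 _ _
          rw [pv_zero_inj]
          exact ⟨by push_cast [Nat.sub_le]; omega, rfl⟩
      · by_cases hα : α.val = k + 1
        · exact Or.inr (Or.inr ⟨b, by rw [pv_zero_inj]; exact ⟨by exact_mod_cast hα.symm, rfl⟩⟩)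
        · refine Or.inl ⟨(⟨α.val, by omega⟩, b), ?_⟩
          show pv 0 _ _ = pv 0 _ _
          rw [pv_zero_inj]
          exact ⟨rfl, rfl⟩
    · simp only [qubitEdge, Sum.elim_inr, Sym2.mem_iff] at hP
      rcases hP with rfl | rfl
      · exact Or.inl ⟨(a, β.castSucc), by show pv 0 _ _ = pv 0 _ _; rw [pv_zero_inj]; simp⟩
      · exact Or.inl ⟨(a, β.succ), by show pv 0 _ _ = pv 0 _ _; rw [pv_zero_inj]; simp [Fin.val_succ]⟩
  bot_eq := by
    have hnot : ∀ (a : ℤ) (b' : Fin (k + 2)), 0 ≤ a → ¬ ∃ b : Fin (k + 2), pv 0 (-1) ↑↑b = pv 0 a ↑↑b' := by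
      rintro a b' ha ⟨b, hb⟩
      have := (pv_zero_inj.1 hb).1
      omega
    rintro (⟨α, b⟩ | ⟨a, β⟩) P P' h
    · simp only [qubitEdge, Sum.elim_inl, Sym2.eq_iff] at h
      have hHi := hnot (α.val : ℤ) b (by positivity)
      simp only [Sum.elim_inl]
      by_cases hα : α.val = 0
      · have hLo : ∃ b₁ : Fin (k + 2), pv 0 (-1) ↑↑b₁ = pv 0 (((α : ℕ) : ℤ) - 1) ↑↑b := ⟨b, by rw [hα]; norm_num⟩
        rw [if_pos hα]
        rcases h with ⟨rfl, rfl⟩ | ⟨rfl, rfl⟩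
        · simp only [hLo, hHi, if_true, if_false, add_zero]
        · simp only [hLo, hHi, if_true, if_false, zero_add]
      · have hLo := hnot (((α : ℕ) : ℤ) - 1) b (by omega)
        rw [if_neg hα]
        rcases h with ⟨rfl, rfl⟩ | ⟨rfl, rfl⟩
        · simp only [hLo, hHi, if_false, add_zero]
        · simp only [hLo, hHi, if_false, add_zero]
    · simp only [qubitEdge, Sum.elim_inr, Sym2.eq_iff] at h
      have h1 := hnot (a.val : ℤ) β.castSucc (by positivity)
      have h2 := hnot (a.val : ℤ) β.succ (by positivity)
      simp only [Sum.elim_inr]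
      have e1 : pv 0 (↑↑a) (↑↑β) = pv 0 ↑↑a ↑↑β.castSucc := by simp
      have e2 : pv 0 (↑↑a) ((((β : ℕ) : ℤ)) + 1) = pv 0 ↑↑a ↑↑β.succ := by simp [Fin.val_succ]
      rw [e1, e2] at h
      rcases h with ⟨rfl, rfl⟩ | ⟨rfl, rfl⟩ <;> simp only [h1, h2, if_false, add_zero]

/-- **Height gap `k + 2`**: the row coordinate is `-1` on the bottom rough edge and `k + 1` on the top one.
[cite: DennisEtAl2002, §5.2 ("at least L links")] -/
theorem planarDrawing_heightGap (k : ℕ) : (planarDrawing k).HeightGap (k + 2) := by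
  refine ⟨Pi.evalAddMonoidHom (fun _ : Fin 2 => ℤ) 0, -1, fun i => ?_, fun b => ?_, fun t => ?_⟩
  · fin_cases i <;> simp
  · show pv 0 (-1) _ 0 = -1
    exact pv_zero_apply_zero _ _
  · show pv 0 ((k : ℤ) + 1) _ 0 = -1 + ((k + 2 : ℕ) : ℤ)
    rw [pv_zero_apply_zero]; push_cast; ring

/-- **The bottom crossing number is the number of bottom rough qubits `(0, b)_L`**: `Σ_q c(q)·bot(q) = Σ_b c((0, b)_L)`.
[cite: DennisEtAl2002, §3.2 (a relative cycle crosses the rough edge)] -/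
theorem sum_mul_planarDrawing_bot (c : PlanarQubit k → ZMod 2) :
    ∑ q, c q * (planarDrawing k).bot q = ∑ b : Fin (k + 2), c (Sum.inl (0, b)) := by
  simp only [planarDrawing, Fintype.sum_sum_type, Sum.elim_inl, Sum.elim_inr, mul_zero, Finset.sum_const_zero, add_zero,
    Fintype.sum_prod_type, mul_ite, mul_one]
  rw [Finset.sum_eq_single (0 : Fin (k + 2))]
  · simp
  · intro α _ hα
    exact Finset.sum_eq_zero fun b _ => if_neg fun h => hα (Fin.ext h)
  · intro h; exact absurd (Finset.mem_univ _) h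

/-! ### The inhomogeneous space-time counting bound -/

open Classical in
/-- ★ **Inhomogeneous space-time counting bound for the planar surface code** (`H_X` sector, `T` rounds): for independent
faults with location-dependent rates `0 ≤ r_ℓ ≤ ρ ≤ 1/2`, a minimum-weight space-time decoder `D` and `cₙ(ℤ³) ≤ C νⁿ` with
`r = 2ν√(ρ(1-ρ)) < 1`, the total probability of the histories whose residual projects to a chain with an odd bottom rough
crossing is `≤ (k+2)·T·C·r^{k+2}/(1-r)`. [cite: DennisEtAl2002, §5.2 eq. (28) (p̃ at the largest rate), §5.3 eqs. (saw_3), (fail_iso)] -/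
theorem planar_st_sum_indepWeight_oddResidual_le {C ν : ℝ} (hν : 0 < ν) (hC : ToricCode.SAWCountBound3 C ν) {T : ℕ}
    {D : STDecoder (PlanarCheck k) (PlanarQubit k) T}
    (hD : D.IsMinWeight (stSyn (planarHX k) T) (stCycles (planarHX k) T) hammingNorm)
    {r : HistoryLoc (PlanarQubit k) (PlanarCheck k) T → ℝ} {ρ : ℝ} (hr0 : ∀ ℓ, 0 ≤ r ℓ) (hrρ : ∀ ℓ, r ℓ ≤ ρ)
    (hρ : ρ ≤ 1 / 2) (hr1 : 2 * ν * Real.sqrt (ρ * (1 - ρ)) < 1) :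
    ∑ E ∈ univ.filter (fun E : History (PlanarCheck k) (PlanarQubit k) T =>
        ∑ b : Fin (k + 2), proj (D (stSyn (planarHX k) T E) + E) (Sum.inl (0, b)) = 1), indepWeight r (supp E) ≤
      ((k : ℝ) + 2) * T * C * (2 * ν * Real.sqrt (ρ * (1 - ρ))) ^ (k + 2) / (1 - 2 * ν * Real.sqrt (ρ * (1 - ρ))) := by
  classical
  have h := ((planarDrawing k).spaceTime T).sum_indepWeight_oddResidual_le
    ((planarDrawing k).spaceTime_heightGap T (planarDrawing_heightGap k)) hν hC (D := D) hD hr0 hrρ hρ hr1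
  rw [Fintype.card_prod, Fintype.card_fin, Fintype.card_fin, Nat.cast_mul] at h
  push_cast at h
  refine le_trans (le_of_eq (Finset.sum_congr (Finset.filter_congr fun E _ => ?_) fun _ _ => rfl)) h
  rw [CheckDrawing.sum_mul_bot_spaceTime, sum_mul_planarDrawing_bot]
  exact Iff.rfl

open Classical in
/-- **Inhomogeneous space-time noise, planar surface codes: `→ 0`** as `k → ∞` for polynomially many rounds, any rate fields
`r k` on the fault locations with `0 ≤ r k ℓ ≤ ρ ≤ 1/2`, every family of minimum-weight space-time decoders of the `H_X`
sector, `cₙ(ℤ³) ≤ C νⁿ`, `4ν² ρ(1-ρ) < 1`. [cite: DennisEtAl2002, §5.3 eqs. (threshold_iso), (fail_iso)] -/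
theorem planar_st_tendsto_sum_indepWeight_oddResidual {C ν : ℝ} (hν : 0 < ν) (hC : ToricCode.SAWCountBound3 C ν)
    {Tk : ℕ → ℕ} (hT : ToricCode.IsPolyBounded Tk) (D : ∀ k, STDecoder (PlanarCheck k) (PlanarQubit k) (Tk k))
    (hD : ∀ k, (D k).IsMinWeight (stSyn (planarHX k) (Tk k)) (stCycles (planarHX k) (Tk k)) hammingNorm)
    (r : ∀ k, HistoryLoc (PlanarQubit k) (PlanarCheck k) (Tk k) → ℝ) {ρ : ℝ} (hρ0 : 0 ≤ ρ)
    (hr0 : ∀ k ℓ, 0 ≤ r k ℓ) (hrρ : ∀ k ℓ, r k ℓ ≤ ρ) (hρ : ρ ≤ 1 / 2) (h4 : 4 * ν ^ 2 * (ρ * (1 - ρ)) < 1) :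
    Tendsto (fun k => ∑ E ∈ univ.filter (fun E : History (PlanarCheck k) (PlanarQubit k) (Tk k) =>
        ∑ b : Fin (k + 2), proj (D k (stSyn (planarHX k) (Tk k) E) + E) (Sum.inl (0, b)) = 1),
        indepWeight (r k) (supp E)) atTop (𝓝 0) := by
  set s := Real.sqrt (ρ * (1 - ρ)) with hs
  set r' := 2 * ν * s with hr
  have hs0 : 0 ≤ s := Real.sqrt_nonneg _
  have hr0' : 0 ≤ r' := by rw [hr]; positivity
  have hpp : 0 ≤ ρ * (1 - ρ) := mul_nonneg hρ0 (by linarith)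
  have hr1 : r' < 1 := by
    have hsq : r' ^ 2 = 4 * ν ^ 2 * (ρ * (1 - ρ)) := by
      rw [hr, mul_pow, mul_pow, hs, Real.sq_sqrt hpp]
      ring
    have h : r' ^ 2 < 1 := by rw [hsq]; exact h4
    have := (sq_lt_one_iff_abs_lt_one r').1 h
    rwa [abs_of_nonneg hr0'] at this
  have h1r : 0 < 1 - r' := by linarith
  have hC0 : 0 ≤ C := by
    have h0 := hC 0
    rw [SAW.Zd.count_zero, pow_zero, mul_one, Nat.cast_one] at h0
    linarith
  -- `(k+2)·T·C·r'^{k+2}/(1-r') ≤ (k+1)·T·(2·C·r'/(1-r'))·r'^{k+1}`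
  refine CheckDrawing.tendsto_of_le_linear_polyRounds_geometric hT (K := 2 * C * r' / (1 - r')) (by positivity) hr0' hr1
    (fun k => Finset.sum_nonneg fun E _ => indepWeight_nonneg (hr0 k) (fun ℓ => (hrρ k ℓ).trans (by linarith)) _)
    fun k => ?_
  refine (planar_st_sum_indepWeight_oddResidual_le hν hC (hD k) (hr0 k) (hrρ k) hρ hr1).trans ?_
  rw [← hs, ← hr]
  have hk2 : (k : ℝ) + 2 ≤ 2 * ((k + 1 : ℕ) : ℝ) := by push_cast; linarith [(Nat.cast_nonneg k : (0 : ℝ) ≤ k)]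
  have hX : 0 ≤ (Tk k : ℝ) * C * r' ^ (k + 2) / (1 - r') := by positivity
  calc ((k : ℝ) + 2) * (Tk k) * C * r' ^ (k + 2) / (1 - r')
      = ((k : ℝ) + 2) * ((Tk k : ℝ) * C * r' ^ (k + 2) / (1 - r')) := by ring
    _ ≤ 2 * ((k + 1 : ℕ) : ℝ) * ((Tk k : ℝ) * C * r' ^ (k + 2) / (1 - r')) := mul_le_mul_of_nonneg_right hk2 hX
    _ = ((k + 1 : ℕ) : ℝ) * (Tk k) * (2 * C * r' / (1 - r')) * r' ^ (k + 1) := by ring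

end PlanarCode

end Literature.InformationTheory.QuantumCodes
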